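import Mathlib
import Summits.Ventures.PercRepro2.Defs
import Summits.Ventures.PercRepro2.Graph
import Summits.Ventures.PercRepro2.Events
import Summits.Ventures.PercRepro2.Harris
import Summits.Ventures.PercRepro2.Independence
import Summits.Ventures.PercRepro2.CutVertexPaths
import Summits.Ventures.PercRepro2.XWForm
import Summits.Ventures.PercRepro2.XWMore

/-!
# The cross W-form (XW) across a cut vertex (PercRepro2, p2 g23)

`XW(p) = xwBil p p = P(aλ) + P(Sa)P(Sλ) − P(a)P(λ) − P(S)P(Saλ)` with `a = {s ↔ u}`,
`λ = {y ↔ o}`, `S = {s ↔ y}` (XWForm.lean).  When a vertex `v` is a cut vertex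
(`CutVertexM9.CutVertex ends side L v Rt`: every edge lies on the left side `L ∪ {v}` or on the
right side `Rt ∪ {v}`), the connection events between vertices of one side read only that side's
edges (`conn_left_congr` / `conn_right_congr`), a cross connection is a conjunction of two
connections to `v` (`conn_cross_iff`), and events reading disjoint edge sets are independent
(`prob_inter_eq_mul_of_dependsOn`).  This gives the exact behaviour of `XW` under every
distribution of the four marks over the two sides:

* `xwBil_eq_zero_of_cut_su_yo` — **the pairs separated** (`s, u` left, `y, o` right): `XW = 0`
  exactly (the bridge / cut-vertex tight family: `Cov(a, λ) = 0` and `Cov_S(a, λ) = 0`);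
* `xwBil_nonneg_of_cut_so_uy` — **`{s, o}` | `{u, y}`**: `XW = P(AO)P(UY) − P(A)P(O)P(U)P(Y) ≥ 0`
  by Harris twice (`A, U, Y, O` = the connections of `s, u, y, o` to `v`): (XW) is a THEOREM on
  this class;
* `xwBil_cut_sy_uo` — **`{s, y}` | `{u, o}`**: `XW(s,y,o,u) ≥ P(U)P(O) · XW(s,y,v,v)`, a reduction
  to the left side with `u = o = v`;
* `xwBil_cut_o_right` / `xwBil_cut_u_right` — a single mark `o` (resp. `u`) on the right:
  `XW(s,y,o,u) = P(O) · XW(s,y,v,u)` (resp. `= P(U) · XW(s,y,o,v)`);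
* `xwBil_nonneg_of_cut_s_right` — a single mark `s` on the right: `0 ≤ XW(v,y,o,u) → 0 ≤ XW(s,y,o,u)`
  (`XW(s,…) = σC − σ²D` with `σ = P(s ↔ v)`, `XW(v,…) = C − D`, `C ≥ 0`).

Together (with the `(s,u) ↔ (y,o)` symmetry `xwBil_swap` for the remaining single-mark case `y`)
these reduce (XW) for every graph to (XW) for its 2-connected blocks (record P2-G23-XW.md).
Own work; standard axioms.
-/

namespace Summit.Ventures.PercRepro2

namespace XWCut

open CutVertexM9

variable {V : Type*} {E : Type*} [Fintype E] [DecidableEq E]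
  {R : Type*} [CommRing R] [LinearOrder R] [IsStrictOrderedRing R]
  {ends : E → Sym2 V} {side : E → Bool} {L : Set V} {v : V} {Rt : Set V}

omit [Fintype E] [DecidableEq E] in
/-- The two sides are disjoint edge sets. -/
lemma disjoint_sides (side : E → Bool) :
    Disjoint ({e | side e = true} : Set E) {e | side e = false} := by
  rw [Set.disjoint_left]
  intro e he he'
  simp only [Set.mem_setOf_eq] at he he'
  rw [he] at he'
  exact Bool.noConfusion he'

omit [Fintype E] [DecidableEq E] in
/-- A connection between two left vertices is determined by the left edges. -/
lemma dependsOn_connEvent_left (h : CutVertex ends side L v Rt) {a b : V}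
    (ha : a ∈ L ∨ a = v) (hb : b ∈ L ∨ b = v) :
    DependsOn (· ∈ connEvent ends a b) {e | side e = true} := by
  intro ω ω' hag
  exact propext (conn_left_congr h ha hb (fun e he => hag e he))

omit [Fintype E] [DecidableEq E] in
/-- A connection between two right vertices is determined by the right edges. -/
lemma dependsOn_connEvent_right (h : CutVertex ends side L v Rt) {a b : V}
    (ha : a ∈ Rt ∨ a = v) (hb : b ∈ Rt ∨ b = v) :
    DependsOn (· ∈ connEvent ends a b) {e | side e = false} := by
  intro ω ω' hag
  exact propext (conn_right_congr h ha hb (fun e he => hag e he))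

omit [Fintype E] [DecidableEq E] in
/-- Intersections of events determined by the same edge set. -/
lemma dependsOn_inter_same {A B : Set (Config E)} {F : Set E} (hA : DependsOn (· ∈ A) F)
    (hB : DependsOn (· ∈ B) F) : DependsOn (· ∈ A ∩ B) F := by
  intro ω ω' hag
  have h1 : (ω ∈ A) = (ω' ∈ A) := hA hag
  have h2 : (ω ∈ B) = (ω' ∈ B) := hB hag
  show (ω ∈ A ∧ ω ∈ B) = (ω' ∈ A ∧ ω' ∈ B)
  rw [h1, h2]

omit [Fintype E] [DecidableEq E] in
/-- A cross connection (left vertex to right vertex) is the conjunction of the two connections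
to the cut vertex, as an equality of events. -/
lemma connEvent_cross (h : CutVertex ends side L v Rt) {a b : V} (ha : a ∈ L ∨ a = v)
    (hb : b ∈ Rt ∨ b = v) :
    connEvent ends a b = connEvent ends a v ∩ connEvent ends b v := by
  ext ω
  exact conn_cross_iff h ha hb ω

omit [LinearOrder R] [IsStrictOrderedRing R] in
/-- Events determined by the two sides are independent. -/
lemma prob_inter_left_right (p : E → R) {A B : Set (Config E)}
    (hA : DependsOn (· ∈ A) {e | side e = true}) (hB : DependsOn (· ∈ B) {e | side e = false}) :
    prob p (A ∩ B) = prob p A * prob p B :=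
  prob_inter_eq_mul_of_dependsOn p (disjoint_sides side) hA hB

/-! ## The pairs separated: `XW = 0` -/

omit [LinearOrder R] [IsStrictOrderedRing R] in
/-- **(XW) is an identity when a cut vertex separates `{s, u}` from `{y, o}`**: with `s, u` on the
left and `y, o` on the right, `a` and `λ` are independent, `S = A ∩ Y` (`A = {s ↔ v}`,
`Y = {y ↔ v}`), and `XW = P(a)P(λ) + P(Aa)P(Y)P(A)P(Yλ) − P(a)P(λ) − P(A)P(Y)P(Aa)P(Yλ) = 0`. -/
theorem xwBil_eq_zero_of_cut_su_yo (h : CutVertex ends side L v Rt) {s u y o : V}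
    (hs : s ∈ L ∨ s = v) (hu : u ∈ L ∨ u = v) (hy : y ∈ Rt ∨ y = v) (ho : o ∈ Rt ∨ o = v)
    (p : E → R) : xwBil ends s y o u p p = 0 := by
  unfold xwBil
  have hS : connEvent ends s y = connEvent ends s v ∩ connEvent ends y v := connEvent_cross h hs hy
  have hA := dependsOn_connEvent_left h hs (Or.inr rfl)
  have ha := dependsOn_connEvent_left h hs hu
  have hY := dependsOn_connEvent_right h hy (Or.inr rfl)
  have hl := dependsOn_connEvent_right h hy ho
  rw [hS]
  have e1 : prob p (connEvent ends s u ∩ connEvent ends y o) =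
      prob p (connEvent ends s u) * prob p (connEvent ends y o) :=
    prob_inter_left_right p ha hl
  have e2 : prob p (connEvent ends s v ∩ connEvent ends y v ∩ connEvent ends s u) =
      prob p (connEvent ends s v ∩ connEvent ends s u) * prob p (connEvent ends y v) := by
    rw [show connEvent ends s v ∩ connEvent ends y v ∩ connEvent ends s u =
        (connEvent ends s v ∩ connEvent ends s u) ∩ connEvent ends y v from
        Set.inter_right_comm _ _ _]
    exact prob_inter_left_right p (dependsOn_inter_same hA ha) hY
  have e3 : prob p (connEvent ends s v ∩ connEvent ends y v ∩ connEvent ends y o) =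
      prob p (connEvent ends s v) * prob p (connEvent ends y v ∩ connEvent ends y o) := by
    rw [Set.inter_assoc]
    exact prob_inter_left_right p hA (dependsOn_inter_same hY hl)
  have e4 : prob p (connEvent ends s v ∩ connEvent ends y v) =
      prob p (connEvent ends s v) * prob p (connEvent ends y v) :=
    prob_inter_left_right p hA hY
  have e5 : prob p (connEvent ends s v ∩ connEvent ends y v ∩ connEvent ends s u ∩
      connEvent ends y o) =
      prob p (connEvent ends s v ∩ connEvent ends s u) *
        prob p (connEvent ends y v ∩ connEvent ends y o) := by
    rw [show connEvent ends s v ∩ connEvent ends y v ∩ connEvent ends s u ∩ connEvent ends y o =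
        (connEvent ends s v ∩ connEvent ends s u) ∩ (connEvent ends y v ∩ connEvent ends y o) by
        ext ω; simp only [Set.mem_inter_iff]; tauto]
    exact prob_inter_left_right p (dependsOn_inter_same hA ha) (dependsOn_inter_same hY hl)
  rw [e1, e2, e3, e4, e5]
  ring

/-! ## `{s, o}` | `{u, y}`: (XW) by Harris -/

/-- **(XW) holds when a cut vertex separates `{s, o}` from `{u, y}`**: with `A, O` the left
connections of `s, o` to `v` and `U, Y` the right connections of `u, y`,
`XW = P(AO)·P(UY) − P(A)P(O)·P(U)P(Y) ≥ 0` (Harris on each side). -/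
theorem xwBil_nonneg_of_cut_so_uy (h : CutVertex ends side L v Rt) {s u y o : V}
    (hs : s ∈ L ∨ s = v) (ho : o ∈ L ∨ o = v) (hu : u ∈ Rt ∨ u = v) (hy : y ∈ Rt ∨ y = v)
    {p : E → R} (hp : IsProbVec p) : 0 ≤ xwBil ends s y o u p p := by
  unfold xwBil
  have hS : connEvent ends s y = connEvent ends s v ∩ connEvent ends y v := connEvent_cross h hs hy
  have ha : connEvent ends s u = connEvent ends s v ∩ connEvent ends u v := connEvent_cross h hs hu
  have hl : connEvent ends y o = connEvent ends o v ∩ connEvent ends y v := by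
    rw [connEvent_comm ends y o]
    exact connEvent_cross h ho hy
  have hA := dependsOn_connEvent_left h hs (Or.inr rfl)
  have hO := dependsOn_connEvent_left h ho (Or.inr rfl)
  have hU := dependsOn_connEvent_right h hu (Or.inr rfl)
  have hY := dependsOn_connEvent_right h hy (Or.inr rfl)
  rw [hS, ha, hl]
  set A := connEvent ends s v with hAdef
  set O := connEvent ends o v with hOdef
  set U := connEvent ends u v with hUdef
  set Y := connEvent ends y v with hYdef
  have e1 : prob p ((A ∩ U) ∩ (O ∩ Y)) = prob p (A ∩ O) * prob p (U ∩ Y) := by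
    rw [show (A ∩ U) ∩ (O ∩ Y) = (A ∩ O) ∩ (U ∩ Y) by
        ext ω; simp only [Set.mem_inter_iff]; tauto]
    exact prob_inter_left_right p (dependsOn_inter_same hA hO) (dependsOn_inter_same hU hY)
  have e2 : prob p ((A ∩ Y) ∩ (A ∩ U)) = prob p A * prob p (U ∩ Y) := by
    rw [show (A ∩ Y) ∩ (A ∩ U) = A ∩ (U ∩ Y) by ext ω; simp only [Set.mem_inter_iff]; tauto]
    exact prob_inter_left_right p hA (dependsOn_inter_same hU hY)
  have e3 : prob p ((A ∩ Y) ∩ (O ∩ Y)) = prob p (A ∩ O) * prob p Y := by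
    rw [show (A ∩ Y) ∩ (O ∩ Y) = (A ∩ O) ∩ Y by ext ω; simp only [Set.mem_inter_iff]; tauto]
    exact prob_inter_left_right p (dependsOn_inter_same hA hO) hY
  have e4 : prob p (A ∩ U) = prob p A * prob p U := prob_inter_left_right p hA hU
  have e5 : prob p (O ∩ Y) = prob p O * prob p Y := prob_inter_left_right p hO hY
  have e6 : prob p (A ∩ Y) = prob p A * prob p Y := prob_inter_left_right p hA hY
  have e7 : prob p ((A ∩ Y) ∩ (A ∩ U) ∩ (O ∩ Y)) = prob p (A ∩ O) * prob p (U ∩ Y) := by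
    rw [show (A ∩ Y) ∩ (A ∩ U) ∩ (O ∩ Y) = (A ∩ O) ∩ (U ∩ Y) by
        ext ω; simp only [Set.mem_inter_iff]; tauto]
    exact prob_inter_left_right p (dependsOn_inter_same hA hO) (dependsOn_inter_same hU hY)
  rw [e1, e2, e3, e4, e5, e6, e7]
  have h1 : prob p A * prob p O ≤ prob p (A ∩ O) :=
    prob_mul_prob_le_prob_inter hp (isUpperSet_connEvent ends s v) (isUpperSet_connEvent ends o v)
  have h2 : prob p U * prob p Y ≤ prob p (U ∩ Y) :=
    prob_mul_prob_le_prob_inter hp (isUpperSet_connEvent ends u v) (isUpperSet_connEvent ends y v)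
  have hAO := prob_nonneg hp (A ∩ O)
  have hUY := prob_nonneg hp (U ∩ Y)
  have hA0 := prob_nonneg hp A
  have hO0 := prob_nonneg hp O
  have hU0 := prob_nonneg hp U
  have hY0 := prob_nonneg hp Y
  have key : prob p A * prob p O * (prob p U * prob p Y) ≤ prob p (A ∩ O) * prob p (U ∩ Y) :=
    mul_le_mul h1 h2 (mul_nonneg hU0 hY0) hAO
  nlinarith [key]

/-! ## `{s, y}` | `{u, o}`: reduction to the left side -/

/-- **`{s, y}` left, `{u, o}` right**: `XW(s,y,o,u) ≥ P(U)·P(O)·XW(s,y,v,v)` — the difference is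
`[P(AY) − P(S)P(SAY)]·[P(UO) − P(U)P(O)] ≥ 0` (`A, Y` = the left connections of `s, y` to `v`,
`U, O` = the right connections of `u, o`). So (XW) on the left side with `u = o = v` gives (XW). -/
theorem xwBil_cut_sy_uo (h : CutVertex ends side L v Rt) {s u y o : V}
    (hs : s ∈ L ∨ s = v) (hy : y ∈ L ∨ y = v) (hu : u ∈ Rt ∨ u = v) (ho : o ∈ Rt ∨ o = v)
    {p : E → R} (hp : IsProbVec p) :
    prob p (connEvent ends u v) * prob p (connEvent ends o v) * xwBil ends s y v v p p ≤
      xwBil ends s y o u p p := by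
  unfold xwBil
  have ha : connEvent ends s u = connEvent ends s v ∩ connEvent ends u v := connEvent_cross h hs hu
  have hl : connEvent ends y o = connEvent ends y v ∩ connEvent ends o v := connEvent_cross h hy ho
  have hA := dependsOn_connEvent_left h hs (Or.inr rfl)
  have hY := dependsOn_connEvent_left h hy (Or.inr rfl)
  have hS := dependsOn_connEvent_left h hs hy
  have hU := dependsOn_connEvent_right h hu (Or.inr rfl)
  have hO := dependsOn_connEvent_right h ho (Or.inr rfl)
  rw [ha, hl]
  set A := connEvent ends s v with hAdef
  set Y := connEvent ends y v with hYdef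
  set U := connEvent ends u v with hUdef
  set O := connEvent ends o v with hOdef
  set S := connEvent ends s y with hSdef
  have e1 : prob p ((A ∩ U) ∩ (Y ∩ O)) = prob p (A ∩ Y) * prob p (U ∩ O) := by
    rw [show (A ∩ U) ∩ (Y ∩ O) = (A ∩ Y) ∩ (U ∩ O) by
        ext ω; simp only [Set.mem_inter_iff]; tauto]
    exact prob_inter_left_right p (dependsOn_inter_same hA hY) (dependsOn_inter_same hU hO)
  have e2 : prob p (S ∩ (A ∩ U)) = prob p (S ∩ A) * prob p U := by
    rw [← Set.inter_assoc]
    exact prob_inter_left_right p (dependsOn_inter_same hS hA) hU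
  have e3 : prob p (S ∩ (Y ∩ O)) = prob p (S ∩ Y) * prob p O := by
    rw [← Set.inter_assoc]
    exact prob_inter_left_right p (dependsOn_inter_same hS hY) hO
  have e4 : prob p (A ∩ U) = prob p A * prob p U := prob_inter_left_right p hA hU
  have e5 : prob p (Y ∩ O) = prob p Y * prob p O := prob_inter_left_right p hY hO
  have e6 : prob p (S ∩ (A ∩ U) ∩ (Y ∩ O)) = prob p (S ∩ A ∩ Y) * prob p (U ∩ O) := by
    rw [show S ∩ (A ∩ U) ∩ (Y ∩ O) = (S ∩ A ∩ Y) ∩ (U ∩ O) by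
        ext ω; simp only [Set.mem_inter_iff]; tauto]
    exact prob_inter_left_right p (dependsOn_inter_same (dependsOn_inter_same hS hA) hY)
      (dependsOn_inter_same hU hO)
  rw [e1, e2, e3, e4, e5, e6]
  have h1 : prob p U * prob p O ≤ prob p (U ∩ O) :=
    prob_mul_prob_le_prob_inter hp (isUpperSet_connEvent ends u v) (isUpperSet_connEvent ends o v)
  have h2 : prob p (S ∩ A ∩ Y) ≤ prob p (A ∩ Y) :=
    prob_mono hp (by intro ω hω; exact ⟨hω.1.2, hω.2⟩)
  have h3 : prob p S ≤ 1 := prob_le_one hp S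
  have h4 := prob_nonneg hp (S ∩ A ∩ Y)
  have h5 : prob p S * prob p (S ∩ A ∩ Y) ≤ prob p (A ∩ Y) :=
    le_trans (mul_le_of_le_one_left h4 h3) h2
  have key : 0 ≤ (prob p (A ∩ Y) - prob p S * prob p (S ∩ A ∩ Y)) *
      (prob p (U ∩ O) - prob p U * prob p O) :=
    mul_nonneg (sub_nonneg.2 h5) (sub_nonneg.2 h1)
  nlinarith [key]

/-! ## A single mark on the right -/

omit [LinearOrder R] [IsStrictOrderedRing R] in
/-- **`o` alone on the right**: `XW(s,y,o,u) = P(O)·XW(s,y,v,u)`, `O = {o ↔ v}`. -/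
theorem xwBil_cut_o_right (h : CutVertex ends side L v Rt) {s u y o : V}
    (hs : s ∈ L ∨ s = v) (hu : u ∈ L ∨ u = v) (hy : y ∈ L ∨ y = v) (ho : o ∈ Rt ∨ o = v)
    (p : E → R) :
    xwBil ends s y o u p p = prob p (connEvent ends o v) * xwBil ends s y v u p p := by
  unfold xwBil
  have hl : connEvent ends y o = connEvent ends y v ∩ connEvent ends o v := connEvent_cross h hy ho
  have ha := dependsOn_connEvent_left h hs hu
  have hY := dependsOn_connEvent_left h hy (Or.inr rfl)
  have hS := dependsOn_connEvent_left h hs hy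
  have hO := dependsOn_connEvent_right h ho (Or.inr rfl)
  rw [hl]
  set a := connEvent ends s u with hadef
  set Y := connEvent ends y v with hYdef
  set O := connEvent ends o v with hOdef
  set S := connEvent ends s y with hSdef
  have e1 : prob p (a ∩ (Y ∩ O)) = prob p (a ∩ Y) * prob p O := by
    rw [← Set.inter_assoc]
    exact prob_inter_left_right p (dependsOn_inter_same ha hY) hO
  have e2 : prob p (S ∩ (Y ∩ O)) = prob p (S ∩ Y) * prob p O := by
    rw [← Set.inter_assoc]
    exact prob_inter_left_right p (dependsOn_inter_same hS hY) hO
  have e3 : prob p (Y ∩ O) = prob p Y * prob p O := prob_inter_left_right p hY hO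
  have e4 : prob p (S ∩ a ∩ (Y ∩ O)) = prob p (S ∩ a ∩ Y) * prob p O := by
    rw [← Set.inter_assoc]
    exact prob_inter_left_right p (dependsOn_inter_same (dependsOn_inter_same hS ha) hY) hO
  rw [e1, e2, e3, e4]
  ring

omit [LinearOrder R] [IsStrictOrderedRing R] in
/-- **`u` alone on the right**: `XW(s,y,o,u) = P(U)·XW(s,y,o,v)`, `U = {u ↔ v}`. -/
theorem xwBil_cut_u_right (h : CutVertex ends side L v Rt) {s u y o : V}
    (hs : s ∈ L ∨ s = v) (hy : y ∈ L ∨ y = v) (ho : o ∈ L ∨ o = v) (hu : u ∈ Rt ∨ u = v)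
    (p : E → R) :
    xwBil ends s y o u p p = prob p (connEvent ends u v) * xwBil ends s y o v p p := by
  unfold xwBil
  have ha : connEvent ends s u = connEvent ends s v ∩ connEvent ends u v := connEvent_cross h hs hu
  have hA := dependsOn_connEvent_left h hs (Or.inr rfl)
  have hl := dependsOn_connEvent_left h hy ho
  have hS := dependsOn_connEvent_left h hs hy
  have hU := dependsOn_connEvent_right h hu (Or.inr rfl)
  rw [ha]
  set A := connEvent ends s v with hAdef
  set l := connEvent ends y o with hldef
  set U := connEvent ends u v with hUdef
  set S := connEvent ends s y with hSdef
  have e1 : prob p ((A ∩ U) ∩ l) = prob p (A ∩ l) * prob p U := by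
    rw [Set.inter_right_comm]
    exact prob_inter_left_right p (dependsOn_inter_same hA hl) hU
  have e2 : prob p (S ∩ (A ∩ U)) = prob p (S ∩ A) * prob p U := by
    rw [← Set.inter_assoc]
    exact prob_inter_left_right p (dependsOn_inter_same hS hA) hU
  have e3 : prob p (A ∩ U) = prob p A * prob p U := prob_inter_left_right p hA hU
  have e4 : prob p (S ∩ (A ∩ U) ∩ l) = prob p (S ∩ A ∩ l) * prob p U := by
    rw [show S ∩ (A ∩ U) ∩ l = (S ∩ A ∩ l) ∩ U by ext ω; simp only [Set.mem_inter_iff]; tauto]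
    exact prob_inter_left_right p (dependsOn_inter_same (dependsOn_inter_same hS hA) hl) hU
  rw [e1, e2, e3, e4]
  ring

/-- **`s` alone on the right**: with `σ = P(s ↔ v)`, `XW(s,y,o,u) = σ·C − σ²·D` and
`XW(v,y,o,u) = C − D`, `C = Cov(U', λ) ≥ 0` (`U' = {u ↔ v}`); hence `0 ≤ XW(v,y,o,u)` gives
`0 ≤ XW(s,y,o,u)` (`σC − σ²D = σ²(C − D) + σ(1 − σ)C`). -/
theorem xwBil_nonneg_of_cut_s_right (h : CutVertex ends side L v Rt) {s u y o : V}
    (hu : u ∈ L ∨ u = v) (hy : y ∈ L ∨ y = v) (ho : o ∈ L ∨ o = v) (hs : s ∈ Rt ∨ s = v)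
    {p : E → R} (hp : IsProbVec p) (hv : 0 ≤ xwBil ends v y o u p p) :
    0 ≤ xwBil ends s y o u p p := by
  unfold xwBil at hv ⊢
  have ha : connEvent ends s u = connEvent ends u v ∩ connEvent ends s v := by
    rw [connEvent_comm ends s u]; exact connEvent_cross h hu hs
  have hSe : connEvent ends s y = connEvent ends y v ∩ connEvent ends s v := by
    rw [connEvent_comm ends s y]; exact connEvent_cross h hy hs
  rw [connEvent_comm ends v u, connEvent_comm ends v y] at hv
  have hU := dependsOn_connEvent_left h hu (Or.inr rfl)
  have hY := dependsOn_connEvent_left h hy (Or.inr rfl)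
  have hl := dependsOn_connEvent_left h hy ho
  have hA := dependsOn_connEvent_right h hs (Or.inr rfl)
  rw [ha, hSe]
  set U := connEvent ends u v with hUdef
  set Y := connEvent ends y v with hYdef
  set l := connEvent ends y o with hldef
  set A := connEvent ends s v with hAdef
  have e1 : prob p ((U ∩ A) ∩ l) = prob p (U ∩ l) * prob p A := by
    rw [Set.inter_right_comm]
    exact prob_inter_left_right p (dependsOn_inter_same hU hl) hA
  have e2 : prob p ((Y ∩ A) ∩ (U ∩ A)) = prob p (Y ∩ U) * prob p A := by
    rw [show (Y ∩ A) ∩ (U ∩ A) = (Y ∩ U) ∩ A by ext ω; simp only [Set.mem_inter_iff]; tauto]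
    exact prob_inter_left_right p (dependsOn_inter_same hY hU) hA
  have e3 : prob p ((Y ∩ A) ∩ l) = prob p (Y ∩ l) * prob p A := by
    rw [Set.inter_right_comm]
    exact prob_inter_left_right p (dependsOn_inter_same hY hl) hA
  have e4 : prob p (U ∩ A) = prob p U * prob p A := prob_inter_left_right p hU hA
  have e5 : prob p (Y ∩ A) = prob p Y * prob p A := prob_inter_left_right p hY hA
  have e6 : prob p ((Y ∩ A) ∩ (U ∩ A) ∩ l) = prob p (Y ∩ U ∩ l) * prob p A := by
    rw [show (Y ∩ A) ∩ (U ∩ A) ∩ l = (Y ∩ U ∩ l) ∩ A by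
        ext ω; simp only [Set.mem_inter_iff]; tauto]
    exact prob_inter_left_right p (dependsOn_inter_same (dependsOn_inter_same hY hU) hl) hA
  rw [e1, e2, e3, e4, e5, e6]
  have hC : prob p U * prob p l ≤ prob p (U ∩ l) :=
    prob_mul_prob_le_prob_inter hp (isUpperSet_connEvent ends u v) (isUpperSet_connEvent ends y o)
  have hσ0 := prob_nonneg hp A
  have hσ1 := prob_le_one hp A
  set σ := prob p A with hσdef
  set C := prob p (U ∩ l) - prob p U * prob p l with hCdef
  set D := prob p Y * prob p (Y ∩ U ∩ l) - prob p (Y ∩ U) * prob p (Y ∩ l) with hDdef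
  have hCD : 0 ≤ C - D := by rw [hCdef, hDdef]; linarith [hv]
  have hC0 : 0 ≤ C := by rw [hCdef]; linarith [hC]
  have key : prob p (U ∩ l) * σ + prob p (Y ∩ U) * σ * (prob p (Y ∩ l) * σ) -
      prob p U * σ * prob p l - prob p Y * σ * (prob p (Y ∩ U ∩ l) * σ) =
      σ ^ 2 * (C - D) + σ * (1 - σ) * C := by
    rw [hCdef, hDdef]; ring
  rw [key]
  have t1 : 0 ≤ σ ^ 2 * (C - D) := mul_nonneg (sq_nonneg σ) hCD
  have t2 : 0 ≤ σ * (1 - σ) * C := mul_nonneg (mul_nonneg hσ0 (sub_nonneg.2 hσ1)) hC0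
  linarith [t1, t2]

/-- **`y` alone on the right** (by the `(s,u) ↔ (y,o)` symmetry `xwBil_swap`): `0 ≤ XW(s,v,o,u)`
gives `0 ≤ XW(s,y,o,u)`. -/
theorem xwBil_nonneg_of_cut_y_right (h : CutVertex ends side L v Rt) {s u y o : V}
    (hs : s ∈ L ∨ s = v) (hu : u ∈ L ∨ u = v) (ho : o ∈ L ∨ o = v) (hy : y ∈ Rt ∨ y = v)
    {p : E → R} (hp : IsProbVec p) (hv : 0 ≤ xwBil ends s v o u p p) :
    0 ≤ xwBil ends s y o u p p := by
  rw [← xwBil_swap]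
  have hv' : 0 ≤ xwBil ends v s u o p p := by rw [xwBil_swap]; exact hv
  exact xwBil_nonneg_of_cut_s_right h ho hs hu hy hp hv'

end XWCut

end Summit.Ventures.PercRepro2
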